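import Mathlib.AlgebraicGeometry.Morphisms.Finite
import Mathlib.AlgebraicGeometry.Morphisms.ClosedImmersion
import Mathlib.AlgebraicGeometry.Morphisms.IsIso
import Summits.ResolutionOfSingularities.ResolutionOfSingularities.Theorems.EquisingularLiftEquisingularLiftNatPushdown
import HarnessLib

/-!
# [OURS · L1 W4.5(b)] EL♮ `EquisingularLiftNat` (stmt-ResolutionOfSingularities-20038), line `sections` —
# helper H-L0a `pushdown_lift_of_nose`, part 2: SCHEME-LEVEL PACKAGING (affine-locally on the target + gluing)

Helper file `--supports stmt-ResolutionOfSingularities-20038` (res-L1-w45b-plan-1 CRUX-PLAN v3.0.1 §1.3 / §4 H-L0a; part 1 =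
`…Theorems.EquisingularLiftEquisingularLiftNatPushdown`, p500010, the Nakayama core). NOT a statement of any manuscript;
OURS plumbing over Mathlib's `AlgebraicGeometry` (`IsAffineHom` / `IsFinite`, `morphismRestrict`, basic opens,
`IsZariskiLocalAtTarget`).

Content. `f : X ⟶ Y`, `V ⊆ Y` an AFFINE open, `r : Γ(Y, V)`, `D(r) := Y.basicOpen r ⊆ V`:
* `app_basicOpen_surjective_of_forall_exists` / `…_injective_of_injective` — for `f` affine, if every section `a` of `X`
  over `f ⁻¹ V` satisfies `f♯ b = f♯ r · a` for some `b` («`r · A ⊆ B`», the output of part 1's non-local Nakayama form),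
  then `f.app D(r)` is surjective (it is the localised map `Γ(Y,V)_r → Γ(X,f⁻¹V)_{f♯ r}` up to an isomorphism — Mathlib
  `IsAffineOpen.app_basicOpen_eq_away_map` + `IsLocalization.Away.map_surjective_iff`); injective if `f.app V` is.
* `isClosedImmersion_morphismRestrict_basicOpen_of_forall_exists` / `isIso_morphismRestrict_basicOpen_of_forall_exists` —
  hence `f ∣_ D(r)` is a closed immersion, resp. an isomorphism (`IsClosedImmersion.of_surjective_of_isAffine`; the
  `HasAffineProperty` instance of `isomorphisms Scheme`).
* `exists_isClosedImmersion_morphismRestrict_basicOpen` / `exists_isIso_morphismRestrict_basicOpen` — **the pushdown lemma,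
  scheme form, over one affine open**: `f` FINITE, `I ⊆ Γ(Y, V)` with `Γ(Y,V) → Γ(X,f⁻¹V) ⧸ I·Γ(X,f⁻¹V)` onto (the base
  change of `f` to `V(I) ⊆ V` is a closed immersion) `⇒` some `r ≡ 1 (mod I)` — so `D(r) ⊇ V(I)`,
  `mem_basicOpen_of_sub_one_mem` — has `f ∣_ D(r)` a closed immersion; an isomorphism if `f.app V` is injective.
* `isClosedImmersion_of_iSup_basicOpen_eq_top` / `isIso_of_iSup_basicOpen_eq_top` — GLUING by Mathlib's
  `IsZariskiLocalAtTarget.of_iSup_eq_top`: if such basic opens cover `Y`, then `f` itself is a closed immersion / an iso.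

Use in CRUX-PLAN v3 §1.3 (nose case (N), `g : C → C̄ ⊆ ℙ³_O`): per affine `V ⊆ C̄` meeting `C̄_k` the `exists_…` lemma
gives `D(r_V) ⊇ V ∩ C̄_k` with `g ∣_ D(r_V)` an iso; properness of `C̄ → Spec O` gives `⨆_V D(r_V) = ⊤`; the gluing lemma
gives `C ≅ C̄`. NOT here: finiteness of `g`, dominance, and the special-fibre closed immersion (the three geometric inputs;
part 1's docstring / STATUS 2026-08-27T05:21:21Z record an elementary route to each). [folklore]
-/

set_option linter.dupNamespace false -- mandated namespace `Summit.<Summit>.<Problem>` of this single-conjunct summit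

noncomputable section

open CategoryTheory AlgebraicGeometry TopologicalSpace

universe u

namespace Summit.ResolutionOfSingularities.ResolutionOfSingularities.Cruxes.EquisingularLiftNat.Sections

/-! ## Small transports (surjectivity / injectivity through isomorphisms and equal opens) -/

/-- Post-composing with an isomorphism of commutative rings preserves surjectivity. [folklore] -/
theorem surjective_hom_comp_of_isIso {R S T : CommRingCat.{u}} (g : R ⟶ S) (e : S ⟶ T) [IsIso e]
    (hg : Function.Surjective g.hom) : Function.Surjective (g ≫ e).hom := by
  rw [CommRingCat.hom_comp]
  exact (ConcreteCategory.bijective_of_isIso e).2.comp hg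

/-- Post-composing with an isomorphism of commutative rings preserves injectivity. [folklore] -/
theorem injective_hom_comp_of_isIso {R S T : CommRingCat.{u}} (g : R ⟶ S) (e : S ⟶ T) [IsIso e]
    (hg : Function.Injective g.hom) : Function.Injective (g ≫ e).hom := by
  rw [CommRingCat.hom_comp]
  exact (ConcreteCategory.bijective_of_isIso e).1.comp hg

variable {X Y : Scheme.{u}} (f : X ⟶ Y)

/-- Transport of surjectivity of `f.app` along an equality of opens. [folklore] -/
theorem app_surjective_of_eq {V W : Y.Opens} (e : V = W) (h : Function.Surjective (f.app W).hom) :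
    Function.Surjective (f.app V).hom := by
  subst e; exact h

/-- Transport of injectivity of `f.app` along an equality of opens. [folklore] -/
theorem app_injective_of_eq {V W : Y.Opens} (e : V = W) (h : Function.Injective (f.app W).hom) :
    Function.Injective (f.app V).hom := by
  subst e; exact h

/-- Post-composing with `X.presheaf.map (eqToHom p).op` (a transport between equal opens) preserves surjectivity.
[folklore] -/
theorem surjective_hom_comp_map_eqToHom {R : CommRingCat.{u}} {A B : X.Opens} (p : A = B)
    (g : R ⟶ Γ(X, B)) (hg : Function.Surjective g.hom) :
    Function.Surjective (g ≫ X.presheaf.map (eqToHom p).op).hom := by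
  subst p
  simpa using hg

/-- Post-composing with `X.presheaf.map (eqToHom p).op` preserves injectivity. [folklore] -/
theorem injective_hom_comp_map_eqToHom {R : CommRingCat.{u}} {A B : X.Opens} (p : A = B)
    (g : R ⟶ Γ(X, B)) (hg : Function.Injective g.hom) :
    Function.Injective (g ≫ X.presheaf.map (eqToHom p).op).hom := by
  subst p
  simpa using hg

/-! ## The localised structure map over a basic open of an affine open of the target -/

section affineOpen

variable {V : Y.Opens} (hV : IsAffineOpen V)
include hV

/-- For an affine morphism, an affine open `V ⊆ Y` and `r : Γ(Y, V)`: if `r · Γ(X, f⁻¹V) ⊆ f♯ Γ(Y, V)` then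
`f.app (Y.basicOpen r)` is surjective (it is the localised map `Γ(Y,V)_r → Γ(X,f⁻¹V)_{f♯ r}` up to an isomorphism).
[folklore] -/
theorem app_basicOpen_surjective_of_forall_exists [IsAffineHom f] (r : Γ(Y, V))
    (hr : ∀ a : Γ(X, f ⁻¹ᵁ V), ∃ b : Γ(Y, V), f.app V b = f.app V r * a) :
    Function.Surjective (f.app (Y.basicOpen r)).hom := by
  have hX : IsAffineOpen (f ⁻¹ᵁ V) := hV.preimage f
  haveI := hV.isLocalization_basicOpen r
  haveI := hX.isLocalization_basicOpen (f.app V r)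
  rw [hV.app_basicOpen_eq_away_map f hX r]
  apply surjective_hom_comp_of_isIso
  rw [CommRingCat.hom_ofHom, IsLocalization.Away.map_surjective_iff]
  intro a
  obtain ⟨b, hb⟩ := hr a
  exact ⟨b, 1, by rw [pow_one]; exact hb⟩

/-- Same, injectivity: if `f.app V` is injective then `f.app (Y.basicOpen r)` is injective. [folklore] -/
theorem app_basicOpen_injective_of_injective [IsAffineHom f] (r : Γ(Y, V))
    (hinj : Function.Injective (f.app V).hom) :
    Function.Injective (f.app (Y.basicOpen r)).hom := by
  have hX : IsAffineOpen (f ⁻¹ᵁ V) := hV.preimage f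
  haveI := hV.isLocalization_basicOpen r
  haveI := hX.isLocalization_basicOpen (f.app V r)
  rw [hV.app_basicOpen_eq_away_map f hX r]
  apply injective_hom_comp_of_isIso
  rw [CommRingCat.hom_ofHom, IsLocalization.Away.map_injective_iff]
  intro a ha
  exact ⟨0, by rw [pow_zero, one_mul]; exact hinj (ha.trans (map_zero _).symm)⟩

/-- `(f ∣_ Y.basicOpen r).appTop` is surjective under «`r · Γ(X, f⁻¹V) ⊆ f♯ Γ(Y, V)`». [folklore] -/
theorem morphismRestrict_basicOpen_appTop_surjective_of_forall_exists [IsAffineHom f] (r : Γ(Y, V))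
    (hr : ∀ a : Γ(X, f ⁻¹ᵁ V), ∃ b : Γ(Y, V), f.app V b = f.app V r * a) :
    Function.Surjective (f ∣_ Y.basicOpen r).appTop.hom := by
  rw [morphismRestrict_appTop]
  exact surjective_hom_comp_map_eqToHom _ _
    (app_surjective_of_eq f (Y.basicOpen r).ι_image_top (app_basicOpen_surjective_of_forall_exists f hV r hr))

/-- `(f ∣_ Y.basicOpen r).appTop` is bijective under «`r · Γ(X, f⁻¹V) ⊆ f♯ Γ(Y, V)`» and injectivity of `f.app V`.
[folklore] -/
theorem morphismRestrict_basicOpen_appTop_bijective_of_forall_exists [IsAffineHom f] (r : Γ(Y, V))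
    (hinj : Function.Injective (f.app V).hom)
    (hr : ∀ a : Γ(X, f ⁻¹ᵁ V), ∃ b : Γ(Y, V), f.app V b = f.app V r * a) :
    Function.Bijective (f ∣_ Y.basicOpen r).appTop.hom := by
  refine ⟨?_, morphismRestrict_basicOpen_appTop_surjective_of_forall_exists f hV r hr⟩
  rw [morphismRestrict_appTop]
  exact injective_hom_comp_map_eqToHom _ _
    (app_injective_of_eq f (Y.basicOpen r).ι_image_top (app_basicOpen_injective_of_injective f hV r hinj))

/-! ## Closed immersion / isomorphism over `D(r)` -/

/-- Over the basic open `D(r) ⊆ V` of an affine open of the target, an affine morphism with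
«`r · Γ(X, f⁻¹V) ⊆ f♯ Γ(Y, V)`» restricts to a CLOSED IMMERSION. [folklore] -/
theorem isClosedImmersion_morphismRestrict_basicOpen_of_forall_exists [IsAffineHom f] (r : Γ(Y, V))
    (hr : ∀ a : Γ(X, f ⁻¹ᵁ V), ∃ b : Γ(Y, V), f.app V b = f.app V r * a) :
    IsClosedImmersion (f ∣_ Y.basicOpen r) := by
  haveI : IsAffine (Y.basicOpen r) := hV.basicOpen r
  haveI : IsAffineHom (f ∣_ Y.basicOpen r) := IsZariskiLocalAtTarget.restrict ‹IsAffineHom f› _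
  haveI : IsAffine (f ⁻¹ᵁ Y.basicOpen r) := isAffine_of_isAffineHom (f ∣_ Y.basicOpen r)
  exact IsClosedImmersion.of_surjective_of_isAffine _
    (morphismRestrict_basicOpen_appTop_surjective_of_forall_exists f hV r hr)

/-- Over the basic open `D(r) ⊆ V` of an affine open of the target, an affine morphism with
«`r · Γ(X, f⁻¹V) ⊆ f♯ Γ(Y, V)`» and `f.app V` injective restricts to an ISOMORPHISM. [folklore] -/
theorem isIso_morphismRestrict_basicOpen_of_forall_exists [IsAffineHom f] (r : Γ(Y, V))
    (hinj : Function.Injective (f.app V).hom)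
    (hr : ∀ a : Γ(X, f ⁻¹ᵁ V), ∃ b : Γ(Y, V), f.app V b = f.app V r * a) :
    IsIso (f ∣_ Y.basicOpen r) := by
  haveI : IsAffine (Y.basicOpen r) := hV.basicOpen r
  haveI : IsAffineHom (f ∣_ Y.basicOpen r) := IsZariskiLocalAtTarget.restrict ‹IsAffineHom f› _
  haveI : IsAffine (f ⁻¹ᵁ Y.basicOpen r) := isAffine_of_isAffineHom (f ∣_ Y.basicOpen r)
  have happ : IsIso (f ∣_ Y.basicOpen r).appTop :=
    (ConcreteCategory.isIso_iff_bijective _).mpr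
      (morphismRestrict_basicOpen_appTop_bijective_of_forall_exists f hV r hinj hr)
  have := (HasAffineProperty.iff_of_isAffine (P := MorphismProperty.isomorphisms Scheme)
    (f := f ∣_ Y.basicOpen r)).mpr ⟨inferInstance, happ⟩
  exact (MorphismProperty.isomorphisms.iff _).mp this

/-! ## The pushdown lemma, scheme form, over one affine open of the target -/

/-- **Pushdown lemma, scheme form, one affine open.** `f : X ⟶ Y` finite, `V ⊆ Y` affine open, `I ⊆ Γ(Y, V)` with
`Γ(Y,V) → Γ(X,f⁻¹V) ⧸ I·Γ(X,f⁻¹V)` surjective (the base change of `f` to `V(I) ⊆ V` is a closed immersion). Then there is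
`r ≡ 1 (mod I)` — so `D(r) ⊇ V(I)`, `mem_basicOpen_of_sub_one_mem` — such that `f ∣_ D(r)` is a closed immersion. (Part 1's
non-local Nakayama form `exists_sub_one_mem_and_smul_mem_range_of_finite` for the finite `Γ(Y,V)`-algebra `Γ(X,f⁻¹V)` +
`isClosedImmersion_morphismRestrict_basicOpen_of_forall_exists`.) [folklore] -/
theorem exists_isClosedImmersion_morphismRestrict_basicOpen [IsFinite f] (I : Ideal Γ(Y, V))
    (h : Function.Surjective ((Ideal.Quotient.mk (I.map (f.app V).hom)).comp (f.app V).hom)) :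
    ∃ r : Γ(Y, V), r - 1 ∈ I ∧ IsClosedImmersion (f ∣_ Y.basicOpen r) := by
  letI : Algebra Γ(Y, V) Γ(X, f ⁻¹ᵁ V) := (f.app V).hom.toAlgebra
  haveI : Module.Finite Γ(Y, V) Γ(X, f ⁻¹ᵁ V) := f.finite_app V hV
  obtain ⟨r, hr1, hr⟩ :=
    exists_sub_one_mem_and_smul_mem_range_of_finite (B := Γ(Y, V)) (A := Γ(X, f ⁻¹ᵁ V)) I h
  refine ⟨r, hr1, isClosedImmersion_morphismRestrict_basicOpen_of_forall_exists f hV r fun a => ?_⟩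
  obtain ⟨b, hb⟩ := LinearMap.mem_range.mp (hr a)
  refine ⟨b, ?_⟩
  rw [Algebra.linearMap_apply, Algebra.smul_def] at hb
  exact hb

/-- **Pushdown lemma, scheme form, one affine open — isomorphism version.** If moreover `f.app V` is injective (`f`
schematically dominant over `V`), then `f ∣_ D(r)` is an isomorphism for some `r ≡ 1 (mod I)`. [folklore] -/
theorem exists_isIso_morphismRestrict_basicOpen [IsFinite f] (I : Ideal Γ(Y, V))
    (hinj : Function.Injective (f.app V).hom)
    (h : Function.Surjective ((Ideal.Quotient.mk (I.map (f.app V).hom)).comp (f.app V).hom)) :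
    ∃ r : Γ(Y, V), r - 1 ∈ I ∧ IsIso (f ∣_ Y.basicOpen r) := by
  letI : Algebra Γ(Y, V) Γ(X, f ⁻¹ᵁ V) := (f.app V).hom.toAlgebra
  haveI : Module.Finite Γ(Y, V) Γ(X, f ⁻¹ᵁ V) := f.finite_app V hV
  obtain ⟨r, hr1, hr⟩ :=
    exists_sub_one_mem_and_smul_mem_range_of_finite (B := Γ(Y, V)) (A := Γ(X, f ⁻¹ᵁ V)) I h
  refine ⟨r, hr1, isIso_morphismRestrict_basicOpen_of_forall_exists f hV r hinj fun a => ?_⟩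
  obtain ⟨b, hb⟩ := LinearMap.mem_range.mp (hr a)
  refine ⟨b, ?_⟩
  rw [Algebra.linearMap_apply, Algebra.smul_def] at hb
  exact hb

end affineOpen

/-! ## `V(I) ⊆ D(r)` for `r ≡ 1 (mod I)` -/

/-- The points of `V(I)` lie in `D(r)` when `r ≡ 1 (mod I)`: if every member of `I ⊆ Γ(Y, U)` vanishes at `y ∈ U`
(`y ∉ Y.basicOpen s` for all `s ∈ I`), then `y ∈ Y.basicOpen r` — in the local ring `𝒪_{Y,y}` the germ of `r` is
`1 + (non-unit)`. [folklore] -/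
theorem mem_basicOpen_of_sub_one_mem {U : Y.Opens} (I : Ideal Γ(Y, U)) (r : Γ(Y, U)) (hr : r - 1 ∈ I)
    (y : Y) (hy : y ∈ U) (hyI : ∀ s ∈ I, y ∉ Y.basicOpen s) : y ∈ Y.basicOpen r := by
  have h1 : ¬ IsUnit (Y.presheaf.germ U y hy (r - 1)) := fun hu =>
    hyI _ hr ((Scheme.mem_basicOpen Y (r - 1) y hy).mpr hu)
  rw [Scheme.mem_basicOpen Y r y hy]
  refine IsLocalRing.isUnit_of_mem_nonunits_one_sub_self _ ?_
  have h2 : (1 : Y.presheaf.stalk y) - Y.presheaf.germ U y hy r = -(Y.presheaf.germ U y hy (r - 1)) := by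
    rw [map_sub, map_one, neg_sub]
  rw [h2, mem_nonunits_iff, IsUnit.neg_iff]
  exact h1

/-! ## Gluing over the target (Mathlib `IsZariskiLocalAtTarget.of_iSup_eq_top`) -/

/-- GLUING, closed-immersion form: if `Y` is covered by basic opens `D(r i) ⊆ V i` (each `V i` affine) over which the
«`r · A ⊆ B`» condition holds, then the affine morphism `f` is a closed immersion. [folklore] -/
theorem isClosedImmersion_of_iSup_basicOpen_eq_top [IsAffineHom f] {ι : Type*} (V : ι → Y.Opens)
    (hV : ∀ i, IsAffineOpen (V i)) (r : ∀ i, Γ(Y, V i)) (hcover : ⨆ i, Y.basicOpen (r i) = ⊤)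
    (hr : ∀ i, ∀ a : Γ(X, f ⁻¹ᵁ V i), ∃ b : Γ(Y, V i), f.app (V i) b = f.app (V i) (r i) * a) :
    IsClosedImmersion f :=
  IsZariskiLocalAtTarget.of_iSup_eq_top (fun i => Y.basicOpen (r i)) hcover fun i =>
    isClosedImmersion_morphismRestrict_basicOpen_of_forall_exists f (hV i) (r i) (hr i)

/-- GLUING, isomorphism form: if `Y` is covered by basic opens `D(r i) ⊆ V i` (each `V i` affine) over which the
«`r · A ⊆ B`» condition holds and each `f.app (V i)` is injective, then the affine morphism `f` is an isomorphism. In the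
pushdown application the cover condition is the properness input (`⨆ D(r_V) ⊇ C̄_k` meets every non-empty closed set).
[folklore] -/
theorem isIso_of_iSup_basicOpen_eq_top [IsAffineHom f] {ι : Type*} (V : ι → Y.Opens)
    (hV : ∀ i, IsAffineOpen (V i)) (r : ∀ i, Γ(Y, V i)) (hcover : ⨆ i, Y.basicOpen (r i) = ⊤)
    (hinj : ∀ i, Function.Injective (f.app (V i)).hom)
    (hr : ∀ i, ∀ a : Γ(X, f ⁻¹ᵁ V i), ∃ b : Γ(Y, V i), f.app (V i) b = f.app (V i) (r i) * a) :
    IsIso f :=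
  (MorphismProperty.isomorphisms.iff _).mp <|
    IsZariskiLocalAtTarget.of_iSup_eq_top (P := MorphismProperty.isomorphisms Scheme)
      (fun i => Y.basicOpen (r i)) hcover fun i =>
      (MorphismProperty.isomorphisms.iff _).mpr
        (isIso_morphismRestrict_basicOpen_of_forall_exists f (hV i) (r i) (hinj i) (hr i))

/-! ## Global form (rev 2): the cover is forced by «every non-empty closed set meets `V(ϖ)`»

The consumer-facing packaging for CRUX-PLAN v3 §1.3: one global section `ϖ : Γ(Y, ⊤)` (the uniformiser pulled back along
`Y → Spec O`), injectivity and `ϖ`-surjectivity of `f♯` affine-locally, and the properness input phrased as «every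
non-empty closed subset of `Y` contains a point where `ϖ` vanishes» (for `Y` proper over `Spec O`, `O` local: the image
of a non-empty closed set is closed in `Spec O`, hence contains the closed point). -/

/-- Points where `ϖ` vanishes lie outside `Y.basicOpen s` for every `s` in the ideal `(ϖ|_U)` of `Γ(Y, U)`. [folklore] -/
theorem not_mem_basicOpen_of_mem_span_res {U : Y.Opens} (ϖ : Γ(Y, ⊤)) (y : Y) (hy : y ∉ Y.basicOpen ϖ)
    (s : Γ(Y, U)) (hs : s ∈ Ideal.span {Y.presheaf.map (homOfLE le_top).op ϖ}) : y ∉ Y.basicOpen s := by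
  obtain ⟨t, rfl⟩ := Ideal.mem_span_singleton'.mp hs
  rw [Scheme.basicOpen_mul, Scheme.basicOpen_res]
  exact fun h => hy h.2.2

/-- **Pushdown lemma, scheme form, GLOBAL — closed-immersion version.** `f : X ⟶ Y` finite; `ϖ : Γ(Y, ⊤)`; on every
affine open `V ⊆ Y` every section of `X` over `f ⁻¹ V` is `f♯ b + f♯(ϖ|_V) · c` (the base change of `f` to `V(ϖ)` is a
closed immersion); and every non-empty closed subset of `Y` contains a point where `ϖ` vanishes. Then `f` is a closed
immersion. [folklore] -/
theorem isClosedImmersion_of_isFinite_of_forall_affineOpens [IsFinite f] (ϖ : Γ(Y, ⊤))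
    (hsurj : ∀ V : Y.affineOpens, ∀ a : Γ(X, f ⁻¹ᵁ V), ∃ b : Γ(Y, V), ∃ c : Γ(X, f ⁻¹ᵁ V),
      a = f.app V b + f.app V (Y.presheaf.map (homOfLE le_top).op ϖ) * c)
    (hspec : ∀ Z : Set Y, IsClosed Z → Z.Nonempty → ∃ y ∈ Z, y ∉ Y.basicOpen ϖ) :
    IsClosedImmersion f := by
  have key : ∀ V : Y.affineOpens, ∃ r : Γ(Y, V),
      r - 1 ∈ Ideal.span {Y.presheaf.map (homOfLE le_top).op ϖ} ∧ IsClosedImmersion (f ∣_ Y.basicOpen r) := by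
    intro V
    letI : Algebra Γ(Y, V) Γ(X, f ⁻¹ᵁ V) := (f.app V).hom.toAlgebra
    exact exists_isClosedImmersion_morphismRestrict_basicOpen f V.2 _
      (surjective_mod_span_singleton_of_forall_exists (B := Γ(Y, V)) (A := Γ(X, f ⁻¹ᵁ V)) _ (hsurj V))
  choose r hr1 hr using key
  refine IsZariskiLocalAtTarget.of_iSup_eq_top (fun V : Y.affineOpens => Y.basicOpen (r V)) ?_ hr
  refine top_le_iff.mp fun y _ => ?_
  by_contra hy
  set W : Y.Opens := ⨆ V : Y.affineOpens, Y.basicOpen (r V)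
  obtain ⟨y', hy'Z, hy'ϖ⟩ := hspec ((W : Set Y)ᶜ) W.isOpen.isClosed_compl ⟨y, hy⟩
  obtain ⟨V, hV⟩ := Opens.mem_iSup.mp
    (show y' ∈ ⨆ i : Y.affineOpens, (i : Y.Opens) by rw [iSup_affineOpens_eq_top]; trivial)
  exact hy'Z (Opens.mem_iSup.mpr ⟨V, mem_basicOpen_of_sub_one_mem _ _ (hr1 V) y' hV
    (not_mem_basicOpen_of_mem_span_res ϖ y' hy'ϖ)⟩)

/-- **Pushdown lemma, scheme form, GLOBAL — isomorphism version.** As above, plus injectivity of `f♯` on affine opens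
(`f` schematically dominant, e.g. `X → (scheme-theoretic image)` via Mathlib `Scheme.Hom.toImage_app_injective`): then `f`
is an isomorphism. In CRUX-PLAN v3 §1.3 (nose case (N)) this is «`C ≅ C̄`, so `C̄ ⊂ ℙ³_O` is a regular `O`-smooth embedded
lift of `Σ`», given: `C → C̄` finite (proper + finite fibres, Mathlib `IsFinite.iff_isProper_and_locallyQuasiFinite`),
dominant (image), `ϖ`-surjective affine-locally (`C_k → C̄_k` a closed immersion), and `C̄` proper over `Spec O`.
[folklore] -/
theorem isIso_of_isFinite_of_forall_affineOpens [IsFinite f] (ϖ : Γ(Y, ⊤))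
    (hinj : ∀ V : Y.affineOpens, Function.Injective (f.app V).hom)
    (hsurj : ∀ V : Y.affineOpens, ∀ a : Γ(X, f ⁻¹ᵁ V), ∃ b : Γ(Y, V), ∃ c : Γ(X, f ⁻¹ᵁ V),
      a = f.app V b + f.app V (Y.presheaf.map (homOfLE le_top).op ϖ) * c)
    (hspec : ∀ Z : Set Y, IsClosed Z → Z.Nonempty → ∃ y ∈ Z, y ∉ Y.basicOpen ϖ) :
    IsIso f := by
  have key : ∀ V : Y.affineOpens, ∃ r : Γ(Y, V),
      r - 1 ∈ Ideal.span {Y.presheaf.map (homOfLE le_top).op ϖ} ∧ IsIso (f ∣_ Y.basicOpen r) := by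
    intro V
    letI : Algebra Γ(Y, V) Γ(X, f ⁻¹ᵁ V) := (f.app V).hom.toAlgebra
    exact exists_isIso_morphismRestrict_basicOpen f V.2 _ (hinj V)
      (surjective_mod_span_singleton_of_forall_exists (B := Γ(Y, V)) (A := Γ(X, f ⁻¹ᵁ V)) _ (hsurj V))
  choose r hr1 hr using key
  refine (MorphismProperty.isomorphisms.iff _).mp <|
    IsZariskiLocalAtTarget.of_iSup_eq_top (P := MorphismProperty.isomorphisms Scheme)
      (fun V : Y.affineOpens => Y.basicOpen (r V)) ?_
      fun V => (MorphismProperty.isomorphisms.iff _).mpr (hr V)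
  refine top_le_iff.mp fun y _ => ?_
  by_contra hy
  set W : Y.Opens := ⨆ V : Y.affineOpens, Y.basicOpen (r V)
  obtain ⟨y', hy'Z, hy'ϖ⟩ := hspec ((W : Set Y)ᶜ) W.isOpen.isClosed_compl ⟨y, hy⟩
  obtain ⟨V, hV⟩ := Opens.mem_iSup.mp
    (show y' ∈ ⨆ i : Y.affineOpens, (i : Y.Opens) by rw [iSup_affineOpens_eq_top]; trivial)
  exact hy'Z (Opens.mem_iSup.mpr ⟨V, mem_basicOpen_of_sub_one_mem _ _ (hr1 V) y' hV
    (not_mem_basicOpen_of_mem_span_res ϖ y' hy'ϖ)⟩)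

/-! ## Discharging the cover hypothesis (rev 3): `Y` universally closed over `Spec` of a local ring

For `q : Y ⟶ Spec O` with `O` local and `q` a closed map (e.g. `[UniversallyClosed q]`, Mathlib `Scheme.Hom.isClosedMap`),
and `ϖ₀ ∈ 𝔪_O` pulled back to `ϖ := q♯ ϖ₀ ∈ Γ(Y, ⊤)`: every non-empty closed subset of `Y` contains a point where `ϖ`
vanishes (a point over the closed point of `Spec O`). This is exactly the `hspec` input of
`isIso_of_isFinite_of_forall_affineOpens` in the pushdown application (`Y = C̄` proper over `Spec O`). -/

/-- A point of `Y` over the closed point of `Spec O` is not in `Y.basicOpen (q♯ ϖ₀)` for `ϖ₀ ∈ 𝔪_O`. [folklore] -/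
theorem not_mem_basicOpen_appTop_of_apply_eq_closedPoint {O : CommRingCat.{u}} [IsLocalRing O] (q : Y ⟶ Spec O)
    (ϖ₀ : O) (hϖ₀ : ϖ₀ ∈ IsLocalRing.maximalIdeal O) (y : Y)
    (hy : q y = IsLocalRing.closedPoint O) :
    y ∉ Y.basicOpen (q.appTop ((Scheme.ΓSpecIso O).inv ϖ₀)) := by
  intro h
  have h' : y ∈ q ⁻¹ᵁ (Spec O).basicOpen ((Scheme.ΓSpecIso O).inv ϖ₀) := by
    rwa [Scheme.preimage_basicOpen_top]
  have h'' : q y ∈ (Spec O).basicOpen ((Scheme.ΓSpecIso O).inv ϖ₀) := h'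
  rw [basicOpen_eq_of_affine] at h''
  have h3 : ϖ₀ ∉ (q y : PrimeSpectrum O).asIdeal := h''
  rw [hy] at h3
  exact h3 hϖ₀

/-- **The cover hypothesis `hspec` from a closed structure map to a local base.** `q : Y ⟶ Spec O` a closed map, `O`
local, `ϖ₀ ∈ 𝔪_O`: every non-empty closed `Z ⊆ Y` contains a point outside `Y.basicOpen (q♯ ϖ₀)` — its image `q(Z)` is
closed and non-empty in `Spec O`, hence contains the closed point (every point of `Spec O` specialises to it).
[folklore] -/
theorem exists_mem_not_mem_basicOpen_of_isClosedMap {O : CommRingCat.{u}} [IsLocalRing O] (q : Y ⟶ Spec O)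
    (hq : IsClosedMap q) (ϖ₀ : O) (hϖ₀ : ϖ₀ ∈ IsLocalRing.maximalIdeal O)
    (Z : Set Y) (hZ : IsClosed Z) (hne : Z.Nonempty) :
    ∃ y ∈ Z, y ∉ Y.basicOpen (q.appTop ((Scheme.ΓSpecIso O).inv ϖ₀)) := by
  obtain ⟨z, hz⟩ := hne
  have hmem : IsLocalRing.closedPoint O ∈ q '' Z :=
    (hq Z hZ).closure_subset_iff.mpr (Set.singleton_subset_iff.mpr ⟨z, hz, rfl⟩)
      ((IsLocalRing.specializes_closedPoint (q z)).mem_closure)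
  obtain ⟨y, hyZ, hy⟩ := hmem
  exact ⟨y, hyZ, not_mem_basicOpen_appTop_of_apply_eq_closedPoint q ϖ₀ hϖ₀ y hy⟩

/-- Same with `[UniversallyClosed q]` (e.g. `q` proper). [folklore] -/
theorem exists_mem_not_mem_basicOpen_of_universallyClosed {O : CommRingCat.{u}} [IsLocalRing O] (q : Y ⟶ Spec O)
    [UniversallyClosed q] (ϖ₀ : O) (hϖ₀ : ϖ₀ ∈ IsLocalRing.maximalIdeal O)
    (Z : Set Y) (hZ : IsClosed Z) (hne : Z.Nonempty) :
    ∃ y ∈ Z, y ∉ Y.basicOpen (q.appTop ((Scheme.ΓSpecIso O).inv ϖ₀)) :=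
  exists_mem_not_mem_basicOpen_of_isClosedMap q q.isClosedMap ϖ₀ hϖ₀ Z hZ hne

/-- **Pushdown lemma, scheme form, over a local base** (the form the nose case (N) consumes): `f : X ⟶ Y` finite,
`q : Y ⟶ Spec O` universally closed with `O` local, `ϖ₀ ∈ 𝔪_O`, `f♯` injective on affine opens and `(q♯ϖ₀)`-surjective on
affine opens `⇒` `f` is an isomorphism. [folklore] -/
theorem isIso_of_isFinite_of_universallyClosed {O : CommRingCat.{u}} [IsLocalRing O] (q : Y ⟶ Spec O)
    [UniversallyClosed q] (ϖ₀ : O) (hϖ₀ : ϖ₀ ∈ IsLocalRing.maximalIdeal O) [IsFinite f]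
    (hinj : ∀ V : Y.affineOpens, Function.Injective (f.app V).hom)
    (hsurj : ∀ V : Y.affineOpens, ∀ a : Γ(X, f ⁻¹ᵁ V), ∃ b : Γ(Y, V), ∃ c : Γ(X, f ⁻¹ᵁ V),
      a = f.app V b + f.app V (Y.presheaf.map (homOfLE le_top).op (q.appTop ((Scheme.ΓSpecIso O).inv ϖ₀))) * c) :
    IsIso f :=
  isIso_of_isFinite_of_forall_affineOpens f _ hinj hsurj
    (exists_mem_not_mem_basicOpen_of_universallyClosed q ϖ₀ hϖ₀)

end Summit.ResolutionOfSingularities.ResolutionOfSingularities.Cruxes.EquisingularLiftNat.Sections
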